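import Summits.QuantumFields.YangMills.Theorems.SwapVirialDeficitTwoScaleCalculusMin
import HarnessLib

/-!
# Two-scale calculus III (PM-IIb″ of LEAD memo `sfw-p2-g96-memo-24196-PM-design.md`): directional derivatives of a function smooth on an OPEN SET, their
# commutation with AFFINE SLICES, and the JOINT continuity of the two-scale remainder `Φ(u, s; y)` in the slice parameter `y`
# (free-hands support of ⟨stmt-QuantumFields-24196⟩ `SwapVirialDeficit.ToronSoftnessSharp`; GENERIC real analysis)

✓`TwoScaleCalculus.eq_pow_four_mul_sq_of_slices` writes each plane slice `F_y = f(·, ·, y)` of a function `f` on `ℝ × ℝ × Y` as `u⁴s²·Φ(u, s; y)` with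
`Φ(·, ·; y) = twoScaleRemainder F_y` continuous in `(u, s)`.  The dominated-convergence step of PM needs `Φ` continuous in `(u, s, y)` JOINTLY where `f` is
`C^∞` (LEAD memo §2: the hub coordinate `a₀` moves with the blow-up parameters).  Since `twoScaleRemainder F_y` is an integral of the mixed sixth
derivative of the SLICE, this file identifies slice derivatives with directional derivatives of `f` itself along `êU = (1,0,0)`, `êS = (0,1,0)`:
* §11 `contDiffOn_dirDeriv` / `contDiffOn_dirDerivIter` on an open set (✓`ContDiffOn.fderiv_of_isOpen`);
* §12 ★ `dirDeriv_comp_affine` / ★ `dirDerivIter_comp_affine` — for `A q = a + L q` affine with `A(E) ⊆ U`: `∂_vᵏ (f ∘ A) = (∂_{Lv}ᵏ f) ∘ A`;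
* §13 ★★ `mixedSix_slice` — `mixedSix (fun q => f (q.1, q.2, y)) (u, s) = (∂_{êS}² ∂_{êU}⁴ f)(u, s, y)`, ★★ `twoScaleRemainder_slice_eq`, and
  ★★★ `continuousOn_twoScaleRemainder_slice` — `(u, s, y) ↦ twoScaleRemainder (f(·,·,y)) u s` is continuous on `ℝ × ℝ × W` whenever `f` is `C^∞` on `ℝ × ℝ × W` (`W` open).
HONEST LABEL: textbook calculus (plumbing for a plan-level fixed-`L` rung of a DRAFT line); nothing of PM, ⟨24196⟩ or ⟨24197⟩ is proved; own crux ⟨22884⟩ OPEN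
(blocked-on ⟨19935⟩); the Yang–Mills mass gap is NOT proved; no summit is proved by a line.
LEAD seat ym-line-sfw-p2 g96 (cell ym-idea-1, free hands), `--supports stmt-QuantumFields-24196`.  Two `abbrev`s (`êU`, `êS`), 0 `def`, standard axioms, 0 `sorry`.
References: [folklore] (chain rule; continuity of parametric integrals).
-/

set_option autoImplicit false

noncomputable section

open Set Filter Topology intervalIntegral
open scoped BigOperators ContDiff

namespace Summit.QuantumFields.YangMills.Theorems.SwapVirialDeficit.TwoScaleCalculus

/-! ## §11 Directional derivatives of a function `C^∞` on an open set -/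

section OpenSet

variable {E : Type*} [NormedAddCommGroup E] [NormedSpace ℝ E] {U : Set E}

/-- `∂_v f` is `C^∞` on an open set where `f` is. [folklore] -/
theorem contDiffOn_dirDeriv {f : E → ℝ} (hf : ContDiffOn ℝ ∞ f U) (hU : IsOpen U) (v : E) : ContDiffOn ℝ ∞ (dirDeriv v f) U := by
  unfold dirDeriv
  have h1 : ContDiffOn ℝ ∞ (fderiv ℝ f) U := hf.fderiv_of_isOpen hU (by simp)
  exact h1.clm_apply contDiffOn_const

/-- `∂_vᵏ f` is `C^∞` on an open set where `f` is. [folklore] -/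
theorem contDiffOn_dirDerivIter {f : E → ℝ} (hf : ContDiffOn ℝ ∞ f U) (hU : IsOpen U) (v : E) (k : ℕ) : ContDiffOn ℝ ∞ (dirDerivIter v k f) U := by
  induction k with
  | zero => simpa using hf
  | succ k ih => rw [dirDerivIter_succ]; exact contDiffOn_dirDeriv ih hU v

end OpenSet

/-! ## §12 Affine slices -/

section Affine

variable {E : Type*} [NormedAddCommGroup E] [NormedSpace ℝ E] {E' : Type*} [NormedAddCommGroup E'] [NormedSpace ℝ E'] {U : Set E'}

/-- ★ **Chain rule for an affine slice**: if `f` is differentiable at `a + L q` then `∂_v (f ∘ (a + L·)) (q) = (∂_{L v} f)(a + L q)`. [folklore] -/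
theorem dirDeriv_comp_affine {f : E' → ℝ} (a : E') (L : E →L[ℝ] E') {q : E} (hf : DifferentiableAt ℝ f (a + L q)) (v : E) :
    dirDeriv v (fun q => f (a + L q)) q = dirDeriv (L v) f (a + L q) := by
  unfold dirDeriv
  have hA : HasFDerivAt (fun q : E => a + L q) L q := (L.hasFDerivAt).const_add a
  have h : HasFDerivAt (fun q : E => f (a + L q)) ((fderiv ℝ f (a + L q)).comp L) q := hf.hasFDerivAt.comp q hA
  rw [h.fderiv]
  rfl

/-- ★ **Iterated chain rule for an affine slice into an open set of smoothness**: `∂_vᵏ (f ∘ A) = (∂_{L v}ᵏ f) ∘ A` when `A(E) ⊆ U`, `U` open, `f` `C^∞` on `U`. [folklore] -/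
theorem dirDerivIter_comp_affine {f : E' → ℝ} (hf : ContDiffOn ℝ ∞ f U) (hU : IsOpen U) (a : E') (L : E →L[ℝ] E') (hA : ∀ q : E, a + L q ∈ U)
    (v : E) (k : ℕ) : dirDerivIter v k (fun q => f (a + L q)) = fun q => dirDerivIter (L v) k f (a + L q) := by
  induction k with
  | zero => rfl
  | succ k ih =>
      rw [dirDerivIter_succ, dirDerivIter_succ, ih]
      funext q
      have hdk : DifferentiableAt ℝ (dirDerivIter (L v) k f) (a + L q) :=
        ((contDiffOn_dirDerivIter hf hU (L v) k).differentiableOn (by simp)).differentiableAt (hU.mem_nhds (hA q))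
      exact dirDeriv_comp_affine a L hdk v

/-- The affine slice of a function `C^∞` on an open set containing the slice is `C^∞`. [folklore] -/
theorem contDiff_comp_affine {f : E' → ℝ} (hf : ContDiffOn ℝ ∞ f U) (a : E') (L : E →L[ℝ] E') (hA : ∀ q : E, a + L q ∈ U) :
    ContDiff ℝ ∞ (fun q => f (a + L q)) :=
  hf.comp_contDiff (contDiff_const.add L.contDiff) hA

end Affine

/-! ## §13 Plane slices of a function on `ℝ × ℝ × Y` -/

section PlaneSlice

variable {Y : Type*} [NormedAddCommGroup Y] [NormedSpace ℝ Y]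

/-- The `u`-direction of `ℝ × ℝ × Y`. [folklore] -/
abbrev êU : ℝ × ℝ × Y := (1, 0, 0)

/-- The `s`-direction of `ℝ × ℝ × Y`. [folklore] -/
abbrev êS : ℝ × ℝ × Y := (0, 1, 0)

/-- The slice embedding `(u, s) ↦ (u, s, y)` as `a + L (u, s)` with `a = (0, 0, y)` and `L = (u, s) ↦ (u, s, 0)`. [folklore] -/
theorem slice_eq_affine (y : Y) (q : ℝ × ℝ) :
    ((q.1, q.2, y) : ℝ × ℝ × Y) = ((0 : ℝ), (0 : ℝ), y) + ((ContinuousLinearMap.id ℝ ℝ).prodMap ((ContinuousLinearMap.inl ℝ ℝ Y))) q := by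
  ext <;> simp

/-- The slice linear map sends `eU ↦ êU` and `eS ↦ êS`. [folklore] -/
theorem sliceMap_eU : ((ContinuousLinearMap.id ℝ ℝ).prodMap (ContinuousLinearMap.inl ℝ ℝ Y)) eU = êU := by ext <;> simp
/-- The slice linear map sends `eS ↦ êS`. [folklore] -/
theorem sliceMap_eS : ((ContinuousLinearMap.id ℝ ℝ).prodMap (ContinuousLinearMap.inl ℝ ℝ Y)) eS = êS := by ext <;> simp

variable {W : Set Y} {f : ℝ × ℝ × Y → ℝ}

omit [NormedSpace ℝ Y] in
/-- The product open set `ℝ × ℝ × W`. [folklore] -/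
theorem isOpen_planeProd (hW : IsOpen W) : IsOpen {p : ℝ × ℝ × Y | p.2.2 ∈ W} :=
  hW.preimage (continuous_snd.comp continuous_snd)

/-- ★★ **The mixed sixth derivative of a slice is the slice of `∂_{êS}²∂_{êU}⁴ f`.** [folklore] -/
theorem mixedSix_slice (hW : IsOpen W) (hf : ContDiffOn ℝ ∞ f {p | p.2.2 ∈ W}) {y : Y} (hy : y ∈ W) (q : ℝ × ℝ) :
    mixedSix (fun q : ℝ × ℝ => f (q.1, q.2, y)) q = dirDerivIter êS 2 (dirDerivIter êU 4 f) (q.1, q.2, y) := by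
  set L : ℝ × ℝ →L[ℝ] ℝ × ℝ × Y := (ContinuousLinearMap.id ℝ ℝ).prodMap (ContinuousLinearMap.inl ℝ ℝ Y) with hL
  set a : ℝ × ℝ × Y := ((0 : ℝ), (0 : ℝ), y) with ha
  have hA : ∀ q : ℝ × ℝ, a + L q ∈ {p : ℝ × ℝ × Y | p.2.2 ∈ W} := fun q => by simpa [ha, hL] using hy
  have hU := isOpen_planeProd hW
  have hslice : (fun q : ℝ × ℝ => f (q.1, q.2, y)) = fun q => f (a + L q) := by
    funext q; rw [slice_eq_affine]
  unfold mixedSix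
  rw [hslice, dirDerivIter_comp_affine hf hU a L hA eU 4, sliceMap_eU]
  have h2 := dirDerivIter_comp_affine (contDiffOn_dirDerivIter hf hU êU 4) hU a L hA eS 2
  rw [h2, sliceMap_eS]
  show dirDerivIter êS 2 (dirDerivIter êU 4 f) (a + L q) = _
  rw [ha, hL, ← slice_eq_affine y q]

/-- ★★ **The two-scale remainder of a slice, as a double integral of the JOINT mixed derivative**:
`twoScaleRemainder (f(·,·,y)) u s = (1/6)∫₀¹(1−t)³∫₀¹(1−τ)·(∂_{êS}²∂_{êU}⁴ f)(tu, τs, y) dτ dt`. [folklore] -/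
theorem twoScaleRemainder_slice_eq (hW : IsOpen W) (hf : ContDiffOn ℝ ∞ f {p | p.2.2 ∈ W}) {y : Y} (hy : y ∈ W) (u s : ℝ) :
    twoScaleRemainder (fun q : ℝ × ℝ => f (q.1, q.2, y)) u s =
      (1 / 6 : ℝ) * ∫ t in (0:ℝ)..1, (1 - t) ^ 3 * ∫ τ in (0:ℝ)..1, (1 - τ) * dirDerivIter êS 2 (dirDerivIter êU 4 f) (t * u, τ * s, y) := by
  unfold twoScaleRemainder
  congr 1
  refine intervalIntegral.integral_congr fun t _ => ?_
  congr 1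
  refine intervalIntegral.integral_congr fun τ _ => ?_
  show (1 - τ) * mixedSix (fun q : ℝ × ℝ => f (q.1, q.2, y)) (t * u, τ * s) = _
  rw [mixedSix_slice hW hf hy]

/-- ★★★ **JOINT CONTINUITY OF THE TWO-SCALE REMAINDER IN THE SLICE PARAMETER**: if `f` is `C^∞` on `ℝ × ℝ × W` (`W` open), then
`(u, s, y) ↦ twoScaleRemainder (f(·,·,y)) u s` is continuous on `ℝ × ℝ × W`. [folklore] -/
theorem continuousOn_twoScaleRemainder_slice (hW : IsOpen W) (hf : ContDiffOn ℝ ∞ f {p | p.2.2 ∈ W}) :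
    ContinuousOn (fun p : ℝ × ℝ × Y => twoScaleRemainder (fun q : ℝ × ℝ => f (q.1, q.2, p.2.2)) p.1 p.2.1) {p | p.2.2 ∈ W} := by
  have hU := isOpen_planeProd hW
  set H6 : ℝ × ℝ × Y → ℝ := dirDerivIter êS 2 (dirDerivIter êU 4 f) with hH6
  have hH6c : ContinuousOn H6 {p : ℝ × ℝ × Y | p.2.2 ∈ W} :=
    (contDiffOn_dirDerivIter (contDiffOn_dirDerivIter hf hU êU 4) hU êS 2).continuousOn
  -- restrict to the subtype `W` to get a globally continuous kernel
  set H : W × (ℝ × ℝ) → ℝ := fun x => H6 (x.2.1, x.2.2, (x.1 : Y)) with hH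
  have hHc : Continuous H := by
    have hι : Continuous fun x : W × (ℝ × ℝ) => ((x.2.1, x.2.2, (x.1 : Y)) : ℝ × ℝ × Y) := by fun_prop
    have hmaps : ∀ x : W × (ℝ × ℝ), ((x.2.1, x.2.2, (x.1 : Y)) : ℝ × ℝ × Y) ∈ {p : ℝ × ℝ × Y | p.2.2 ∈ W} := fun x => x.1.2
    exact hH6c.comp_continuous hι hmaps
  have hR := continuous_twoScaleRemainder_param hHc
  -- transfer back along `p ↦ (⟨p.2.2, _⟩, (p.1, p.2.1))`
  rw [continuousOn_iff_continuous_restrict]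
  have hκ : Continuous fun p : {p : ℝ × ℝ × Y | p.2.2 ∈ W} => ((⟨p.1.2.2, p.2⟩ : W), (p.1.1, p.1.2.1)) := by
    refine (Continuous.subtype_mk (by fun_prop) _).prodMk (by fun_prop)
  refine (hR.comp hκ).congr fun p => ?_
  simp only [Function.comp_apply, Set.restrict_apply, hH]
  rw [twoScaleRemainder_slice_eq hW hf p.2 p.1.1 p.1.2.1]

end PlaneSlice

end Summit.QuantumFields.YangMills.Theorems.SwapVirialDeficit.TwoScaleCalculus

end
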